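import Summits.HodgeConjecture.HodgeConjecture.Theorems.EightfoldBlochSeedsChernCharacterOnBettiAnalytificationFlagBundle
import Literature.AlgebraicGeometry.HodgeTheory.SurjectiveOfPullbackInjective
import HarnessLib

/-!
# K1 → the cycle law `ch_mem_algebraicClasses` for every vector bundle, granted `SplittingPrincipleBetti`

Route `EightfoldBlochSeeds` / item `stmt-HodgeConjecture-19780` (`ChernCharacterOnBetti`), helper
(`--supports`). HONEST FRAMING: nothing here proves 19780 / 18880 / 18882 / 18883 / H2 / HC_AV / HC;
no definition; each theorem is CONDITIONAL on exactly one named fact of the tree, taken as a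
hypothesis (D-0014).

WHAT. `…AnalytificationFlagBundle` proved the field `ch_mem_algebraicClasses` of `ChernCharacterBetti`
— `ch_k(E) ∈ algebraicClasses X k` and `cᵢ(E)_ℂ ∈ algebraicClasses X i` for every vector bundle `F` on a
smooth projective `X`, every analytification datum `(E, α)` of `F`, all `k`, `i` — granted
`FlagBundleSplitting`. The tree now knows (all PROVED):
`ProjectiveBundleTautologicalQuotient → FlagBundleSplitting ↔ SplittingPrincipleBetti`
(`flagBundleSplitting_of_projectiveBundleTautologicalQuotient`, Fulton §3.2 by induction on the rank;
`flagBundleSplitting_iff_splittingPrincipleBetti`, Voisin I Lemma 7.28 and its top-degree converse).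
This file restates the cycle law under the hypothesis `SplittingPrincipleBetti`, so that the K2ᵀᴿ
consumers (crux `stmt-HodgeConjecture-27388`, LEMMA U), who already carry
`(hSP : SplittingPrincipleBetti)`, get the cycle law from the SAME hypothesis
(`…_of_splittingPrincipleBetti`); a construction seat building one level of `𝐏(ℰ) → X` with
`π^*ℰ ↠ 𝒪(1)` (Hartshorne II Prop. 7.11) discharges it outright through
`flagBundleSplitting_of_projectiveBundleTautologicalQuotient`.

[cite: Grothendieck1958, §2] [cite: Fulton1998, §3.2 and Prop. 19.1.2]
[cite: VoisinHodgeI2002, §7.3.2 Lemma 7.28, Lemma 7.32 and Thm. 7.33] [cite: Hartshorne1977, II §7 Prop. 7.11]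
-/

noncomputable section

-- single-problem summit (Problem = Summit): the mandated namespace repeats `HodgeConjecture`.
set_option linter.dupNamespace false

open CategoryTheory AlgebraicGeometry Bundle Topology
open Literature.AlgebraicGeometry.Motives Literature.AlgebraicGeometry.HodgeTheory Literature.AlgebraicGeometry.Modules
open Literature.AlgebraicTopology.SingularHomology Literature.AlgebraicTopology.CharacteristicClasses

namespace Summit.HodgeConjecture.HodgeConjecture.Theorems

variable {n : ℕ} {X : SchemeOver ℂ} {F : X.left.Modules}

/-- **The cycle law for every vector bundle, granted `SplittingPrincipleBetti`** (the hypothesis the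
K2ᵀᴿ / LEMMA U consumers already carry): every vector bundle `F` on a smooth projective `X` over `ℂ`
has a topological analytification `(E, α)` all of whose Chern character components `ch_k(E)` and
complexified Chern classes `cᵢ(E)_ℂ` are algebraic classes.
[cite: Grothendieck1958, §2] [cite: VoisinHodgeI2002, §7.3.2 Lemma 7.28, Lemma 7.32 and Thm. 7.33]
[cite: Fulton1998, §3.2 and Prop. 19.1.2] -/
theorem exists_analytification_topologicalChernCharacter_mem_algebraicClasses_of_splittingPrincipleBetti
    (hSP : SplittingPrincipleBetti) (hX : IsSmoothProjective n X) (hF : IsVectorBundle F) :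
    ∃ (r : ℕ) (E : ComplexVectorBundle.{0, 0} (ComplexPoints X))
      (α : ∀ U : X.left.Opens, Γ(F, U) → ∀ P : ComplexPoints X, E.E P),
      E.rank = r ∧
      (∀ x : X.left, ∃ (U : X.left.Opens) (s : Fin r → Γ(F, U)), x ∈ U ∧ IsSectionFrame F U s) ∧
      (∀ (U : X.left.Opens) (σ τ : Γ(F, U)) (P : ComplexPoints X),
          α U (σ + τ) P = α U σ P + α U τ P) ∧
      (∀ (U : X.left.Opens) (f : Γ(X.left, U)) (σ : Γ(F, U)) (P : ComplexPoints X) (h : P.pt ∈ U),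
          α U (f • σ) P = P.eval U h f • α U σ P) ∧
      (∀ (U W : X.left.Opens) (hWU : W ≤ U) (σ : Γ(F, U)) (P : ComplexPoints X), P.pt ∈ W →
          α W (F.presheaf.map (homOfLE hWU).op σ) P = α U σ P) ∧
      (∀ (U : X.left.Opens) (σ : Γ(F, U)),
          ContinuousOn (fun P ↦ (⟨P, α U σ P⟩ : TotalSpace E.F E.E)) {P | P.pt ∈ U}) ∧
      (∀ (U : X.left.Opens) (t : Fin r → Γ(F, U)), IsSectionFrame F U t → ∀ P : ComplexPoints X,
          P.pt ∈ U → LinearIndependent ℂ (fun j ↦ α U (t j) P) ∧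
            ⊤ ≤ Submodule.span ℂ (Set.range fun j ↦ α U (t j) P)) ∧
      (∀ k : ℕ, theChernClassTheory.topologicalChernCharacter ℂ E k ∈ algebraicClasses X k) ∧
      (∀ i : ℕ, theChernClassTheory.chernClassIn ℂ E i ∈ algebraicClasses X i) :=
  exists_analytification_topologicalChernCharacter_mem_algebraicClasses
    (flagBundleSplitting_of_splittingPrincipleBetti hSP) hX hF

/-- **Per-datum form, granted `SplittingPrincipleBetti`**: `ch_k(E) ∈ algebraicClasses X k` for EVERY
analytification datum `(E, α)` of a vector bundle `F` on a smooth projective `X` and every `k`.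
[cite: Grothendieck1958, §2] [cite: VoisinHodgeI2002, §7.3.2 Lemma 7.28 and Thm. 7.33]
[cite: Fulton1998, §3.2 and Prop. 19.1.2] -/
theorem topologicalChernCharacter_mem_algebraicClasses_of_comparison_of_splittingPrincipleBetti
    (hSP : SplittingPrincipleBetti) (hX : IsSmoothProjective n X) (hF : IsVectorBundle F) {r : ℕ}
    (hFr : ∀ x : X.left, ∃ (U : X.left.Opens) (s : Fin r → Γ(F, U)), x ∈ U ∧ IsSectionFrame F U s)
    (E : ComplexVectorBundle.{0, 0} (ComplexPoints X))
    (α : ∀ U : X.left.Opens, Γ(F, U) → ∀ P : ComplexPoints X, E.E P)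
    (hadd : ∀ (U : X.left.Opens) (σ τ : Γ(F, U)) (P : ComplexPoints X), α U (σ + τ) P = α U σ P + α U τ P)
    (hsmul : ∀ (U : X.left.Opens) (f : Γ(X.left, U)) (σ : Γ(F, U)) (P : ComplexPoints X) (h : P.pt ∈ U),
      α U (f • σ) P = P.eval U h f • α U σ P)
    (hres : ∀ (U W : X.left.Opens) (hWU : W ≤ U) (σ : Γ(F, U)) (P : ComplexPoints X), P.pt ∈ W →
      α W (F.presheaf.map (homOfLE hWU).op σ) P = α U σ P)
    (hcont : ∀ (U : X.left.Opens) (σ : Γ(F, U)),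
      ContinuousOn (fun P ↦ (⟨P, α U σ P⟩ : TotalSpace E.F E.E)) {P | P.pt ∈ U})
    (hframe : ∀ (U : X.left.Opens) (t : Fin r → Γ(F, U)), IsSectionFrame F U t →
      ∀ P : ComplexPoints X, P.pt ∈ U → LinearIndependent ℂ (fun j ↦ α U (t j) P) ∧
        ⊤ ≤ Submodule.span ℂ (Set.range fun j ↦ α U (t j) P)) (k : ℕ) :
    theChernClassTheory.topologicalChernCharacter ℂ E k ∈ algebraicClasses X k :=
  topologicalChernCharacter_mem_algebraicClasses_of_comparison
    (flagBundleSplitting_of_splittingPrincipleBetti hSP) hX hF hFr E α hadd hsmul hres hcont hframe k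

end Summit.HodgeConjecture.HodgeConjecture.Theorems

end
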